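import Summits.HodgeConjecture.CorCM.PointwiseConjugationCompositum
import HarnessLib

/-!
# Pointwise partial conjugations: the ONE-SUBFIELD TEST — `y₀(k) ⊄ x(K_a) · y₀(K_b⁺)` for any totally complex `k ≤ K_b`

COR-CM (cell `pub-hodgecm2`, binder seat `b16` gen 48, count-neutral claim PTCONJ, file F6 — Galois theory in `ℂ`;
theorems only, no definition, no named fact, no `sorry`).  NEW as stated, hence under `Summits/`.  HONEST FRAMING: a
field-theoretic criterion and its consequences for NAMED classes of CM abelian varieties; `HC_CM` is neither used nor
asserted.

Sequel of `PointwiseConjugationCompositum` (this seat), where the pointwise partial conjugation at `(x, y₀)`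
(`σ ∈ Aut(ℂ)`, `σ ∘ x = x̄`, `σ ∘ y₀ = y₀`) was shown to exist iff `N ⊄ M · N⁺` (`M = x(K_a)`, `N = y₀(K_b)`,
`N⁺ = y₀(K_b⁺)`).  The test shrinks to ANY totally complex subfield:

> **Theorem** (`exists_conj_smul_iff_not_le_of_subfield`).  Let `e : k ↪ K_b` with `k` a totally complex number field
> (an imaginary quadratic subfield, any CM subfield, `K_b` itself).  Then
> `∃ σ, σ ∘ x = x̄ ∧ σ ∘ y₀ = y₀`  **iff**  `y₀(e(k)) ⊄ x(K_a) · y₀(K_b⁺)`.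

So for a CM field with an imaginary quadratic subfield `k = ℚ(√−d)` (every `K_b = F·k`, `F` totally real) the whole
criterion is ONE ELEMENT: `y₀(√−d) ∉ x(K_a) · y₀(F)` for every conjugate `x(K_a)` — and by DESCENT the same `k` tests
every CM overfield of `k` at once.  PROOF.  ⟹ (`not_le_of_conj_smul_of_subfield`): `τ = conj ∘ σ` fixes `M` and `N⁺`
pointwise, hence `M · N⁺` (`apply_eq_of_mem_sup_of_conj_smul`); on `y₀(e(k))` the map `σ` is the identity, so
containment would make `conj` the identity there — `y₀ ∘ e` would be a real embedding of `k`.  ⟸: `y₀(e(k)) ≤ N`, so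
`N ≤ M · N⁺` is excluded, and `exists_conj_smul_of_not_le` applies.

CONSEQUENCES (§2): `pairwise_of_forall_not_le_of_subfield`, `isNondegenerateFamily_iff_pair_of_forall_not_le_of_subfield`,
`hodgeConjectureFor_prod_pair_of_forall_not_le_of_subfield` (HC + `B• = D•` on every `A_a^m × A_b^n` for nondegenerate
realisations, unconditional), and for nondegenerate types the equivalence `pairwise_iff_forall_not_le_of_subfield`.

## References

* [Lang2002] S. Lang, *Algebra*, GTM 211, V §2 Thm. 2.8, VI §1 Thm. 1.12.
* [Shimura1998] G. Shimura, *Abelian Varieties with Complex Multiplication and Modular Functions*, §18.2 Lemma.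
* [MoonenZarhin1999LowDim] B. Moonen, Yu. Zarhin, *Hodge classes on abelian varieties of low dimension*, Math. Ann.
  315 (1999), Thm. (0.2) (a) (the shape "`k ↪ End⁰`" of the obstruction).
* [Gordon1999HodgeAVSurvey] B. B. Gordon, *A survey of the Hodge conjecture for abelian varieties*, §3, 7.5, 10.10.
-/

noncomputable section

open CategoryTheory CategoryTheory.Limits NumberField NumberField.ComplexEmbedding IntermediateField
open scoped BigOperators IntermediateField

namespace Summit.HodgeConjecture.CorCM

open Literature.NumberTheory.ComplexMultiplication
open Literature.AlgebraicGeometry.Motives (AbelianVariety CMType)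
open Literature.AlgebraicGeometry.HodgeTheory
open Literature.AlgebraicGeometry.ComplexMultiplication (IsCMTypeRealisation)
open Literature.AlgebraicGeometry.VanGeemen1994 (hodgeClassSpan)
open Literature.AlgebraicGeometry.Pohlmann1968
open Literature.Barriers.HodgeConjecture (divisorClassesSpan)

/-! ## §1 The one-subfield test -/

section Test

variable {I : Type} {K : I → Type} [∀ i, Field (K i)] [∀ i, NumberField (K i)] [∀ i, IsCMField (K i)]
variable {k : Type} [Field k] [NumberField k]

omit [∀ i, IsCMField (K i)] in
/-- **`conj ∘ σ` fixes the compositum `x(K_a) · y₀(K_b⁺)` pointwise** when `σ ∘ x = x̄` and `σ ∘ y₀ = y₀` (it fixes `x(K_a)`,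
where `σ` is conjugation, and the real field `y₀(K_b⁺)`, where `σ` is the identity; the fixed field of an automorphism
is an intermediate field). [cite: Lang2002, VI §1 Thm. 1.12] -/
theorem apply_eq_of_mem_sup_of_conj_smul {a b : I} {x : K a →+* ℂ} {y₀ : K b →+* ℂ} {σ : ℂ ≃+* ℂ}
    (hσx : σ • x = (starRingAut : ℂ ≃+* ℂ) • x) (hσy : σ • y₀ = y₀) {z : ℂ}
    (hz : z ∈ x.toRatAlgHom.fieldRange ⊔ (y₀.comp (maximalRealSubfield (K b)).subtype).toRatAlgHom.fieldRange) :
    starRingEnd ℂ (σ z) = z := by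
  -- `τ = conj ∘ σ` as a `ℚ`-algebra automorphism of `ℂ`, and its fixed field
  set τ : ℂ ≃+* ℂ := σ.trans (starRingAut : ℂ ≃+* ℂ) with hτ_def
  have hτ : ∀ w, τ w = starRingEnd ℂ (σ w) := fun w => rfl
  let τA : ℂ ≃ₐ[ℚ] ℂ := AlgEquiv.ofRingEquiv (f := τ) fun q => by rw [eq_ratCast]; exact map_ratCast τ q
  have hτA : ∀ w, τA w = τ w := fun _ => rfl
  set F : IntermediateField ℚ ℂ := IntermediateField.fixedField (Subgroup.zpowers τA) with hF_def
  have hF : ∀ w : ℂ, w ∈ F ↔ τ w = w := by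
    intro w
    rw [hF_def, IntermediateField.mem_fixedField_iff, Subgroup.forall_mem_zpowers, ← hτA]
    exact (MulAction.mem_fixedBy_zpowers_iff_mem_fixedBy (α := ℂ) (g := τA) (a := w))
  have hM : x.toRatAlgHom.fieldRange ≤ F := by
    intro w hw
    obtain ⟨v, rfl⟩ := AlgHom.mem_fieldRange.1 hw
    rw [hF, hτ]
    change starRingEnd ℂ (σ (x v)) = x v
    rw [← ringEquiv_smul_apply σ x v, hσx, ringEquiv_smul_apply, starRingAut_apply, ← starRingEnd_apply,
      starRingEnd_self_apply]
  have hR : (y₀.comp (maximalRealSubfield (K b)).subtype).toRatAlgHom.fieldRange ≤ F := by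
    intro w hw
    obtain ⟨⟨r, hr⟩, rfl⟩ := AlgHom.mem_fieldRange.1 hw
    rw [hF, hτ]
    change starRingEnd ℂ (σ (y₀ r)) = y₀ r
    rw [← ringEquiv_smul_apply σ y₀ r, hσy]
    exact (mem_maximalRealSubfield_iff r).1 hr y₀
  have hzF : z ∈ F := (sup_le hM hR) hz
  rw [hF, hτ] at hzF
  exact hzF

omit [∀ i, IsCMField (K i)] in
/-- **⟹ of the one-subfield test.**  `σ ∘ x = x̄`, `σ ∘ y₀ = y₀` and a totally complex `k ↪ K_b` (by `e`) force
`y₀(e(k)) ⊄ x(K_a) · y₀(K_b⁺)`: on `y₀(e(k))` the map `conj ∘ σ = conj` would be the identity, i.e. `y₀ ∘ e` real.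
[cite: MoonenZarhin1999LowDim, Thm. (0.2) (a)] [cite: Lang2002, VI §1 Thm. 1.12] -/
theorem not_le_of_conj_smul_of_subfield [IsTotallyComplex k] {a b : I} (e : k →+* K b) {x : K a →+* ℂ}
    {y₀ : K b →+* ℂ} {σ : ℂ ≃+* ℂ} (hσx : σ • x = (starRingAut : ℂ ≃+* ℂ) • x) (hσy : σ • y₀ = y₀) :
    ¬ (y₀.comp e).toRatAlgHom.fieldRange ≤
      x.toRatAlgHom.fieldRange ⊔ (y₀.comp (maximalRealSubfield (K b)).subtype).toRatAlgHom.fieldRange := by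
  intro hle
  have hreal : ComplexEmbedding.IsReal (y₀.comp e) := by
    rw [ComplexEmbedding.isReal_iff]
    refine RingHom.ext fun w => ?_
    rw [ComplexEmbedding.conjugate_coe_eq, RingHom.comp_apply]
    have h1 := apply_eq_of_mem_sup_of_conj_smul hσx hσy (hle (AlgHom.mem_fieldRange.2 ⟨w, rfl⟩))
    -- `h1 : conj (σ (y₀ (e w))) = y₀ (e w)`, and `σ (y₀ (e w)) = y₀ (e w)`
    have h2 : σ (y₀ (e w)) = y₀ (e w) := by rw [← ringEquiv_smul_apply σ y₀ (e w), hσy]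
    change starRingEnd ℂ (σ ((y₀.comp e).toRatAlgHom w)) = (y₀.comp e).toRatAlgHom w at h1
    change starRingEnd ℂ (σ (y₀ (e w))) = y₀ (e w) at h1
    rwa [h2] at h1
  exact IsTotallyComplex.complexEmbedding_not_isReal (y₀.comp e) hreal

omit [∀ i, IsCMField (K i)] in
/-- `y₀(e(k)) ≤ y₀(K_b)`. [folklore] -/
private theorem fieldRange_comp_le {b : I} (e : k →+* K b) (y₀ : K b →+* ℂ) :
    (y₀.comp e).toRatAlgHom.fieldRange ≤ y₀.toRatAlgHom.fieldRange := by
  intro w hw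
  obtain ⟨v, rfl⟩ := AlgHom.mem_fieldRange.1 hw
  exact AlgHom.mem_fieldRange.2 ⟨e v, rfl⟩

/-- **The one-subfield test.**  For a totally complex `k ↪ K_b` (by `e`):
`∃ σ ∈ Aut(ℂ), σ ∘ x = x̄ ∧ σ ∘ y₀ = y₀` **iff** `y₀(e(k)) ⊄ x(K_a) · y₀(K_b⁺)`.  (⟸: `y₀(e(k)) ≤ y₀(K_b)`, so
`y₀(K_b) ⊄ x(K_a) · y₀(K_b⁺)` and the compositum criterion applies.)
[cite: Lang2002, V §2 Thm. 2.8 and VI §1 Thm. 1.12] [cite: MoonenZarhin1999LowDim, Thm. (0.2) (a)] -/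
theorem exists_conj_smul_iff_not_le_of_subfield [IsTotallyComplex k] {a b : I} (e : k →+* K b) (x : K a →+* ℂ)
    (y₀ : K b →+* ℂ) :
    (∃ σ : ℂ ≃+* ℂ, σ • x = (starRingAut : ℂ ≃+* ℂ) • x ∧ σ • y₀ = y₀) ↔
    ¬ (y₀.comp e).toRatAlgHom.fieldRange ≤
      x.toRatAlgHom.fieldRange ⊔ (y₀.comp (maximalRealSubfield (K b)).subtype).toRatAlgHom.fieldRange :=
  ⟨fun ⟨_, hσx, hσy⟩ => not_le_of_conj_smul_of_subfield e hσx hσy,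
    fun h => exists_conj_smul_of_not_le x y₀ fun hle => h ((fieldRange_comp_le e y₀).trans hle)⟩

/-- **(PC) by the one-subfield test**: every pair of embeddings admits a pointwise partial conjugation iff
`y₀(e(k)) ⊄ x(K_a) · y₀(K_b⁺)` for every conjugate `x(K_a)` (one base point `y₀`, one totally complex `k ↪ K_b`).
[cite: Lang2002, V §2 Thm. 2.8 and VI §1 Thm. 1.12] -/
theorem pointwiseConj_iff_forall_not_le_of_subfield [IsTotallyComplex k] {a b : I} (e : k →+* K b)
    (y₀ : K b →+* ℂ) :
    (∀ (x : K a →+* ℂ) (y : K b →+* ℂ), ∃ σ : ℂ ≃+* ℂ, σ • x = (starRingAut : ℂ ≃+* ℂ) • x ∧ σ • y = y) ↔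
    ∀ x : K a →+* ℂ, ¬ (y₀.comp e).toRatAlgHom.fieldRange ≤
      x.toRatAlgHom.fieldRange ⊔ (y₀.comp (maximalRealSubfield (K b)).subtype).toRatAlgHom.fieldRange :=
  ⟨fun h x => (exists_conj_smul_iff_not_le_of_subfield e x y₀).1 (h x y₀),
    fun h => pointwiseConj_of_basePoint y₀ fun x => (exists_conj_smul_iff_not_le_of_subfield e x y₀).2 (h x)⟩

end Test

/-! ## §2 Consequences -/

section Consequences

variable {I : Type} {K : I → Type} [∀ i, Field (K i)] [∀ i, NumberField (K i)] [∀ i, IsCMField (K i)]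
variable {k : Type} [Field k] [NumberField k] [IsTotallyComplex k]

/-- **The one-subfield test ⟹ no common constituent** (both orders, all CM types).
[cite: Gordon1999HodgeAVSurvey, §3 Theorem (proof)] -/
theorem pairwise_of_forall_not_le_of_subfield (Φ : ∀ i, CMType (K i)) {a b : I} (e : k →+* K b) (y₀ : K b →+* ℂ)
    (h : ∀ x : K a →+* ℂ, ¬ (y₀.comp e).toRatAlgHom.fieldRange ≤
      x.toRatAlgHom.fieldRange ⊔ (y₀.comp (maximalRealSubfield (K b)).subtype).toRatAlgHom.fieldRange) :
    (∀ P : Submodule ℚ ((K a →+* ℂ) → ℚ), P ≤ antiSpan (ℂ ≃+* ℂ) (Φ a).1 →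
      (∀ g : ℂ ≃+* ℂ, ∀ f ∈ P, (fun x => f (g • x)) ∈ P) →
      ∀ T : ((K a →+* ℂ) → ℚ) →ₗ[ℚ] ((K b →+* ℂ) → ℚ),
        (∀ g : ℂ ≃+* ℂ, ∀ f ∈ P, T (fun x => f (g • x)) = fun y => T f (g • y)) →
        (∀ f ∈ P, T f ∈ antiSpan (ℂ ≃+* ℂ) (Φ b).1) → (∀ f ∈ P, T f = 0 → f = 0) → P = ⊥) ∧
    (∀ P : Submodule ℚ ((K b →+* ℂ) → ℚ), P ≤ antiSpan (ℂ ≃+* ℂ) (Φ b).1 →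
      (∀ g : ℂ ≃+* ℂ, ∀ f ∈ P, (fun x => f (g • x)) ∈ P) →
      ∀ T : ((K b →+* ℂ) → ℚ) →ₗ[ℚ] ((K a →+* ℂ) → ℚ),
        (∀ g : ℂ ≃+* ℂ, ∀ f ∈ P, T (fun x => f (g • x)) = fun y => T f (g • y)) →
        (∀ f ∈ P, T f ∈ antiSpan (ℂ ≃+* ℂ) (Φ a).1) → (∀ f ∈ P, T f = 0 → f = 0) → P = ⊥) :=
  pairwise_of_pointwiseConj_basePoint Φ y₀ fun x => (exists_conj_smul_iff_not_le_of_subfield e x y₀).2 (h x)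

variable [Fintype I] [DecidableEq I]

/-- **Two slots under the one-subfield test: nondegenerate iff both members are** (all CM types).
[cite: Gordon1999HodgeAVSurvey, §3 Theorem and 7.5] -/
theorem isNondegenerateFamily_iff_pair_of_forall_not_le_of_subfield {i₀ i₁ : I} (h01 : i₀ ≠ i₁)
    (hI : ∀ j, j = i₀ ∨ j = i₁) (Φ : ∀ i, CMType (K i)) (e : k →+* K i₁) (y₀ : K i₁ →+* ℂ)
    (h : ∀ x : K i₀ →+* ℂ, ¬ (y₀.comp e).toRatAlgHom.fieldRange ≤
      x.toRatAlgHom.fieldRange ⊔ (y₀.comp (maximalRealSubfield (K i₁)).subtype).toRatAlgHom.fieldRange) :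
    CMAlgebra.IsNondegenerateFamily Φ ↔ ∀ i, IsNondegenerate (Φ i) :=
  isNondegenerateFamily_iff_pair_of_pointwiseConj h01 hI Φ y₀
    fun x => (exists_conj_smul_iff_not_le_of_subfield e x y₀).2 (h x)

/-- **Two slots under the one-subfield test: `Hg(A₀ × A₁) = Hg(A₀) × Hg(A₁)`** (all CM types).
[cite: Gordon1999HodgeAVSurvey, §3 Theorem (1)] -/
theorem cmFamilyRank_add_card_eq_pair_of_forall_not_le_of_subfield {i₀ i₁ : I} (h01 : i₀ ≠ i₁)
    (hI : ∀ j, j = i₀ ∨ j = i₁) (Φ : ∀ i, CMType (K i)) (e : k →+* K i₁) (y₀ : K i₁ →+* ℂ)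
    (h : ∀ x : K i₀ →+* ℂ, ¬ (y₀.comp e).toRatAlgHom.fieldRange ≤
      x.toRatAlgHom.fieldRange ⊔ (y₀.comp (maximalRealSubfield (K i₁)).subtype).toRatAlgHom.fieldRange) :
    CMAlgebra.cmFamilyRank Φ + Fintype.card I = (∑ i, cmTypeRank (Φ i)) + 1 :=
  cmFamilyRank_add_card_eq_pair_of_pointwiseConj h01 hI Φ y₀
    fun x => (exists_conj_smul_iff_not_le_of_subfield e x y₀).2 (h x)

variable {Φ : ∀ i, CMType (K i)} {A : I → AbelianVariety ℂ} {ι : ∀ i, 𝓞 (K i) →+* End (A i)}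
  {θ : ∀ i, K i →+* Module.End ℂ (complexBetti (A i).X 1)}

/-- **Two CM abelian varieties of nondegenerate types passing the one-subfield test** (`y₀(e(k)) ⊄ x(K_{i₀}) · y₀(K_{i₁}⁺)`
for every `x`, `k ↪ K_{i₁}` totally complex): the Hodge conjecture and `B• = D•` on EVERY `A₀^m × A₁^n`,
UNCONDITIONALLY. [cite: Gordon1999HodgeAVSurvey, §3 Theorem, 7.5 and 10.10] [cite: MoonenZarhin1999LowDim, Thm. (0.2) (4)] -/
theorem hodgeConjectureFor_prod_pair_of_forall_not_le_of_subfield {i₀ i₁ : I} (h01 : i₀ ≠ i₁)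
    (hI : ∀ j, j = i₀ ∨ j = i₁) (e : k →+* K i₁) (y₀ : K i₁ →+* ℂ)
    (h : ∀ x : K i₀ →+* ℂ, ¬ (y₀.comp e).toRatAlgHom.fieldRange ≤
      x.toRatAlgHom.fieldRange ⊔ (y₀.comp (maximalRealSubfield (K i₁)).subtype).toRatAlgHom.fieldRange)
    (hΦ : ∀ i, IsNondegenerate (Φ i)) (hA : ∀ i, IsCMTypeRealisation (Φ i) (A i) (ι i) (θ i)) {N : ℕ}
    (π : Fin N → I) :
    HodgeConjectureFor (⨁ fun j : Fin N => A (π j)).dim (⨁ fun j : Fin N => A (π j)).X ∧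
      ∀ m : ℕ, hodgeClassSpan (⨁ fun j : Fin N => A (π j)).dim (⨁ fun j : Fin N => A (π j)).X m =
        divisorClassesSpan (⨁ fun j : Fin N => A (π j)).X (⨁ fun j : Fin N => A (π j)).dim m :=
  hodgeConjectureFor_prod_pair_of_pointwiseConj h01 hI y₀
    (fun x => (exists_conj_smul_iff_not_le_of_subfield e x y₀).2 (h x)) hΦ hA π

omit [Fintype I] [DecidableEq I] in
/-- **The decision by one subfield, nondegenerate types**: the slots `a → b` have no common constituent **iff**
`y₀(e(k)) ⊄ x(K_a) · y₀(K_b⁺)` for every conjugate `x(K_a)`. [cite: Gordon1999HodgeAVSurvey, §3 Theorem and 7.5] -/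
theorem pairwise_iff_forall_not_le_of_subfield (Φ : ∀ i, CMType (K i)) {a b : I} (ha : IsNondegenerate (Φ a))
    (hb : IsNondegenerate (Φ b)) (e : k →+* K b) (y₀ : K b →+* ℂ) :
    (∀ P : Submodule ℚ ((K a →+* ℂ) → ℚ), P ≤ antiSpan (ℂ ≃+* ℂ) (Φ a).1 →
      (∀ g : ℂ ≃+* ℂ, ∀ f ∈ P, (fun x => f (g • x)) ∈ P) →
      ∀ T : ((K a →+* ℂ) → ℚ) →ₗ[ℚ] ((K b →+* ℂ) → ℚ),
        (∀ g : ℂ ≃+* ℂ, ∀ f ∈ P, T (fun x => f (g • x)) = fun y => T f (g • y)) →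
        (∀ f ∈ P, T f ∈ antiSpan (ℂ ≃+* ℂ) (Φ b).1) → (∀ f ∈ P, T f = 0 → f = 0) → P = ⊥) ↔
    ∀ x : K a →+* ℂ, ¬ (y₀.comp e).toRatAlgHom.fieldRange ≤
      x.toRatAlgHom.fieldRange ⊔ (y₀.comp (maximalRealSubfield (K b)).subtype).toRatAlgHom.fieldRange := by
  rw [pairwise_iff_pointwiseConj_basePoint Φ ha hb y₀]
  exact forall_congr' fun x => exists_conj_smul_iff_not_le_of_subfield e x y₀

end Consequences

end Summit.HodgeConjecture.CorCM

end
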